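import Summits.ResolutionOfSingularities.ResolutionOfSingularities.Theorems.WildConesClassicalRegimesStubMuDropCharTwoOrdPSurface

/-!
# Milnor drop in characteristic two (`stub_muDropCharTwoOrdP`) — helper 9: Induction

Helper file for the stub `stub_muDropCharTwoOrdP` of crux `ClassicalRegimes`
(stmt-ResolutionOfSingularities-16884, route `WildCones`, line `milnor-descent`): the one-step drop
of the Milnor number `μ = dim_κ κ⟦u₁,…,uₙ⟧/(∂a)` of the cleaned state of `z² = a(u)` under the
point-blow-up dynamics in characteristic two, `n ≥ 3`.

This file: THE INDUCTION on the number of variables, entirely on the power-series side. For a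
series `a` of order `≥ 2`, a chart index `i`, a translation vector `τ` and a series `G` WITHOUT
LINEAR TERMS with `X_i² G = a∘Φ_{i,τ}` (`Φ_{i,τ} : X_i ↦ X_i, X_s ↦ X_i (X_s + τ_s)`), if both Milnor
algebras `κ⟦X⟧/(∂a)` and `κ⟦X⟧/(∂G)` are finite over `κ` then
`dim_κ κ⟦X⟧/(∂G) < dim_κ κ⟦X⟧/(∂a)` (`series_drop`). Proof by strong induction on `n`: if the
quadratic part of `a` has a square-free monomial then (`exists_pair_ne`, helper BlowFam) it has one
`X_j X_l` avoiding the chart index, and the descent step (`descent_step`, helper Descent) produces a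
pair `a', G'` in `n - 2` variables in the same relation with isomorphic Milnor algebras; otherwise
`n ≥ 3` is impossible (`caseA_not_finite`, helper Leaves), `n = 1` is `curve_drop` (helper Leaves) and
`n = 2` is `surface_drop` (helper Surface) — after renaming the two variables when the chart index is
`1` (`surface_drop_any`; renaming by a permutation transports the relation `X_i² G = a∘Φ` and the
Milnor algebras, `rename_subst_blowFam`, `milnorAlg_equiv_rename`). Also the embedding of the
complement of a pair of indices (`exists_emb_compl_pair`).
Sources: G.-M. Greuel, G. Pfister, *The splitting lemma in any characteristic*, J. Algebra 689
(2026) = arXiv:2507.17078, Thm. 3.5 / Cor. 3.7 (the hyperbolic pair); folklore otherwise.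
-/

noncomputable section

-- single-problem summit: the doubled namespace component `ResolutionOfSingularities` is forced
set_option linter.dupNamespace false

open scoped BigOperators Classical

open MvPowerSeries IsLocalRing

open Literature.AlgebraicGeometry.Resolution

namespace Summit.ResolutionOfSingularities.ResolutionOfSingularities.Theorems.WildCones

namespace MuDropCharTwoOrdP

variable {κ : Type} [Field κ]

/-! ## Renaming the variables by a permutation -/

section Rename

variable {n : ℕ} (w : Fin n ≃ Fin n)

/-- Renaming by a permutation maps the blow-up family of `(i, τ)` to the blow-up family of
`(w i, τ ∘ w⁻¹)`. [folklore] -/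
theorem rename_blowFam (i : Fin n) (τ : Fin n → κ) (s : Fin n) :
    rename w ((fun s => if s = i then (X i : MvPowerSeries (Fin n) κ)
      else X i * (X s + C (τ s))) s) =
      (fun t => if t = w i then (X (w i) : MvPowerSeries (Fin n) κ)
        else X (w i) * (X t + C (τ (w.symm t)))) (w s) := by
  by_cases hs : s = i
  · subst hs
    simp only [if_true, rename_X]
  · have hws : w s ≠ w i := fun h => hs (w.injective h)
    simp only [if_neg hs, if_neg hws, map_mul, map_add, rename_X, rename_C, Equiv.symm_apply_apply]

/-- Renaming by a permutation transports `a∘Φ_{i,τ}` to `(w·a)∘Φ_{w i, τ∘w⁻¹}`. [folklore] -/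
theorem rename_subst_blowFam (i : Fin n) (τ : Fin n → κ) (a : MvPowerSeries (Fin n) κ) :
    rename w (subst (fun s => if s = i then (X i : MvPowerSeries (Fin n) κ)
      else X i * (X s + C (τ s))) a) =
      subst (fun t => if t = w i then (X (w i) : MvPowerSeries (Fin n) κ)
        else X (w i) * (X t + C (τ (w.symm t)))) (rename w a) := by
  have hΦ := hasSubst_blowFam (κ := κ) i τ
  have hΦ' := hasSubst_blowFam (κ := κ) (w i) (fun t => τ (w.symm t))
  have hXw : HasSubst (X ∘ w : Fin n → MvPowerSeries (Fin n) κ) := HasSubst.X_comp _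
  rw [rename_eq_subst, rename_eq_subst, subst_comp_subst_apply hΦ hXw,
    subst_comp_subst_apply hXw hΦ']
  congr 1
  funext s
  rw [← rename_eq_subst, rename_blowFam, Function.comp_apply, subst_X hΦ']

/-- CHAIN RULE for a renaming by a permutation: `∂ₛ (w·f) = w·(∂_{w⁻¹ s} f)`. [folklore] -/
theorem pderiv_rename_equiv (s : Fin n) (f : MvPowerSeries (Fin n) κ) :
    MvPowerSeries.pderiv s (rename w f) = rename w (MvPowerSeries.pderiv (w.symm s) f) := by
  rw [rename_eq_subst, show (X ∘ ⇑w : Fin n → MvPowerSeries (Fin n) κ) = fun t => X (w t) from rfl,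
    MvPowerSeries.pderiv_subst (fun t => constantCoeff_X _) s, Finset.sum_eq_single (w.symm s)]
  · rw [MvPowerSeries.pderiv_X, Equiv.apply_symm_apply, if_pos rfl, mul_one,
      show (fun t => X (w t) : Fin n → MvPowerSeries (Fin n) κ) = X ∘ ⇑w from rfl, ← rename_eq_subst]
  · intro t _ ht
    rw [MvPowerSeries.pderiv_X, if_neg, mul_zero]
    intro h
    exact ht (by rw [← h, Equiv.symm_apply_apply])
  · intro h
    exact absurd (Finset.mem_univ _) h

/-- The Jacobian ideal of a renamed series is the renamed Jacobian ideal. [folklore] -/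
theorem span_pderiv_rename (f : MvPowerSeries (Fin n) κ) :
    Ideal.span (Set.range fun s => MvPowerSeries.pderiv s (rename w f)) =
      (Ideal.span (Set.range fun s => MvPowerSeries.pderiv s f)).map
        (renameEquiv κ w : MvPowerSeries (Fin n) κ →+* MvPowerSeries (Fin n) κ) := by
  rw [Ideal.map_span, ← Set.range_comp]
  have h1 : (fun s => MvPowerSeries.pderiv s (rename w f)) =
      ((renameEquiv κ w : MvPowerSeries (Fin n) κ →+* MvPowerSeries (Fin n) κ) ∘
        fun s => MvPowerSeries.pderiv s f) ∘ w.symm := by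
    funext s
    rw [Function.comp_apply, Function.comp_apply, pderiv_rename_equiv]
    rfl
  rw [h1, w.symm.surjective.range_comp]

/-- Renaming by a permutation does not change the Milnor algebra. [folklore] -/
theorem milnorAlg_equiv_rename (f : MvPowerSeries (Fin n) κ) :
    Nonempty ((MvPowerSeries (Fin n) κ ⧸ Ideal.span (Set.range fun s => MvPowerSeries.pderiv s f))
      ≃ₐ[κ] (MvPowerSeries (Fin n) κ ⧸
        Ideal.span (Set.range fun s => MvPowerSeries.pderiv s (rename w f)))) :=
  ⟨Ideal.quotientEquivAlg _ _ (renameEquiv κ w) (span_pderiv_rename w f)⟩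

/-- Linear coefficients of a renamed series. [folklore] -/
theorem coeff_single_rename (s : Fin n) (f : MvPowerSeries (Fin n) κ) :
    coeff (Finsupp.single (w s) 1) (rename w f) = coeff (Finsupp.single s 1) f := by
  have h := coeff_embDomain_rename w.toEmbedding f (Finsupp.single s 1)
  rw [Finsupp.embDomain_single] at h
  exact h

/-- Quadratic coefficients of a renamed series. [folklore] -/
theorem coeff_pair_rename (s t : Fin n) (f : MvPowerSeries (Fin n) κ) :
    coeff (Finsupp.single (w s) 1 + Finsupp.single (w t) 1) (rename w f) =
      coeff (Finsupp.single s 1 + Finsupp.single t 1) f := by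
  have h := coeff_embDomain_rename w.toEmbedding f (Finsupp.single s 1 + Finsupp.single t 1)
  rw [Finsupp.embDomain_add, Finsupp.embDomain_single, Finsupp.embDomain_single] at h
  exact h

end Rename

/-! ## The surface leaf in either chart -/

section SurfaceAny

/-- **THE SURFACE LEAF, either chart** (characteristic two, `n = 2`): `surface_drop` after renaming
the two variables when the chart index is `1`. [folklore] -/
theorem surface_drop_any [CharP κ 2] (i : Fin 2) (τ : Fin 2 → κ) {a G : MvPowerSeries (Fin 2) κ}
    (ha : 2 ≤ a.order) (hnopair : coeff (Finsupp.single 0 1 + Finsupp.single 1 1) a = 0)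
    (hG : X i ^ 2 * G = subst (fun s => if s = i then (X i : MvPowerSeries (Fin 2) κ)
      else X i * (X s + C (τ s))) a)
    (hfa : Module.Finite κ (MvPowerSeries (Fin 2) κ ⧸
      Ideal.span (Set.range fun s => MvPowerSeries.pderiv s a)))
    (hfG : Module.Finite κ (MvPowerSeries (Fin 2) κ ⧸
      Ideal.span (Set.range fun s => MvPowerSeries.pderiv s G))) :
    Module.finrank κ (MvPowerSeries (Fin 2) κ ⧸
        Ideal.span (Set.range fun s => MvPowerSeries.pderiv s G)) <
      Module.finrank κ (MvPowerSeries (Fin 2) κ ⧸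
        Ideal.span (Set.range fun s => MvPowerSeries.pderiv s a)) := by
  by_cases hi : i = 0
  · subst hi
    exact surface_drop τ ha hnopair hG hfa hfG
  · have hi1 : i = 1 := by
      fin_cases i
      · exact absurd rfl hi
      · rfl
    subst hi1
    -- rename by the transposition `w = (0 1)`
    set w : Fin 2 ≃ Fin 2 := Equiv.swap 0 1 with hw
    have hw1 : w 1 = 0 := by rw [hw, Equiv.swap_apply_right]
    have hw0 : w 0 = 1 := by rw [hw, Equiv.swap_apply_left]
    obtain ⟨εa⟩ := milnorAlg_equiv_rename w a
    obtain ⟨εG⟩ := milnorAlg_equiv_rename w G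
    haveI hfa' : Module.Finite κ (MvPowerSeries (Fin 2) κ ⧸
        Ideal.span (Set.range fun s => MvPowerSeries.pderiv s (rename w a))) :=
      Module.Finite.equiv εa.toLinearEquiv
    haveI hfG' : Module.Finite κ (MvPowerSeries (Fin 2) κ ⧸
        Ideal.span (Set.range fun s => MvPowerSeries.pderiv s (rename w G))) :=
      Module.Finite.equiv εG.toLinearEquiv
    rw [εa.toLinearEquiv.finrank_eq, εG.toLinearEquiv.finrank_eq]
    have hG' : X (0 : Fin 2) ^ 2 * rename w G = subst (fun s => if s = (0 : Fin 2) then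
        (X 0 : MvPowerSeries (Fin 2) κ) else X 0 * (X s + C ((fun t => τ (w.symm t)) s))) (rename w a) := by
      have h := congrArg (rename w) hG
      rw [map_mul, map_pow, rename_X, hw1, rename_subst_blowFam, hw1] at h
      exact h
    refine surface_drop (fun t => τ (w.symm t)) ?_ ?_ hG' hfa' hfG'
    · have := le_order_algEquiv (renameEquiv κ w) ha
      rwa [renameEquiv_apply] at this
    · have h := coeff_pair_rename w 1 0 a
      rw [hw1, hw0] at h
      rw [h, add_comm, hnopair]

end SurfaceAny

/-! ## The induction on the number of variables -/

section Induction

/-- The complement of a pair of distinct indices `j ≠ l` in `Fin n` is the range of an embedding of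
`Fin (n - 2)`. [folklore] -/
theorem exists_emb_compl_pair {n : ℕ} {j l : Fin n} (hjl : j ≠ l) :
    ∃ e : Fin (n - 2) ↪ Fin n, ∀ s, s ∈ Set.range e ↔ s ≠ j ∧ s ≠ l := by
  set S : Finset (Fin n) := (Finset.univ.erase j).erase l with hS
  have hl : l ∈ Finset.univ.erase j := Finset.mem_erase.mpr ⟨Ne.symm hjl, Finset.mem_univ l⟩
  have hcard : S.card = n - 2 := by
    rw [hS, Finset.card_erase_of_mem hl, Finset.card_erase_of_mem (Finset.mem_univ j),
      Finset.card_univ, Fintype.card_fin]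
    omega
  refine ⟨(S.orderEmbOfFin hcard).toEmbedding, fun s => ?_⟩
  rw [show Set.range ⇑(S.orderEmbOfFin hcard).toEmbedding = Set.range ⇑(S.orderEmbOfFin hcard)
    from rfl, Finset.range_orderEmbOfFin, Finset.mem_coe, hS, Finset.mem_erase, Finset.mem_erase]
  simp only [Finset.mem_univ, and_true]
  exact ⟨fun h => ⟨h.2, h.1⟩, fun h => ⟨h.2, h.1⟩⟩

/-- **THE INDUCTION (`series_drop`).** In characteristic two, for a series `a` of order `≥ 2`, a
chart index `i`, a translation vector `τ` and a series `G` WITHOUT LINEAR TERMS such that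
`X_i² G = a∘Φ_{i,τ}`: if both Milnor algebras `κ⟦X⟧/(∂a)`, `κ⟦X⟧/(∂G)` are finite over `κ`, then
`dim_κ κ⟦X⟧/(∂G) < dim_κ κ⟦X⟧/(∂a)`. Strong induction on the number of variables: hyperbolic
pair ⇒ descent by two variables (`exists_pair_ne`, `descent_step`); no pair ⇒ `n ≥ 3` impossible
(`caseA_not_finite`), `n = 1` `curve_drop`, `n = 2` `surface_drop_any`.
[cite: GreuelPfister2026, Thm 3.5 and Cor 3.7] -/
theorem series_drop [CharP κ 2] : ∀ (n : ℕ) (i : Fin n) (τ : Fin n → κ)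
    (a G : MvPowerSeries (Fin n) κ), 2 ≤ a.order → (∀ s, coeff (Finsupp.single s 1) G = 0) →
    X i ^ 2 * G = subst (fun s => if s = i then (X i : MvPowerSeries (Fin n) κ)
      else X i * (X s + C (τ s))) a →
    Module.Finite κ (MvPowerSeries (Fin n) κ ⧸
      Ideal.span (Set.range fun s => MvPowerSeries.pderiv s a)) →
    Module.Finite κ (MvPowerSeries (Fin n) κ ⧸
      Ideal.span (Set.range fun s => MvPowerSeries.pderiv s G)) →
    Module.finrank κ (MvPowerSeries (Fin n) κ ⧸
        Ideal.span (Set.range fun s => MvPowerSeries.pderiv s G)) <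
      Module.finrank κ (MvPowerSeries (Fin n) κ ⧸
        Ideal.span (Set.range fun s => MvPowerSeries.pderiv s a)) := by
  intro n
  induction n using Nat.strong_induction_on with
  | _ n ih =>
  intro i τ a G ha hG0 hG hfa hfG
  by_cases hpair : ∃ j l : Fin n, j ≠ l ∧ coeff (Finsupp.single j 1 + Finsupp.single l 1) a ≠ 0
  · -- a hyperbolic pair avoiding the chart index: descend by two variables
    obtain ⟨j, l, hjl, hj, hl, hq⟩ := exists_pair_ne i τ ha hG hG0 hpair
    obtain ⟨e, he⟩ := exists_emb_compl_pair hjl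
    obtain ⟨i', hi'⟩ : ∃ i', e i' = i := (he i).mpr ⟨Ne.symm hj, Ne.symm hl⟩
    have hlt : n - 2 < n := by
      have : 0 < n := Fin.pos i
      omega
    obtain ⟨a', G', ha', hG0', hG', ⟨εa⟩, ⟨εG⟩⟩ :=
      descent_step i τ ha hG0 hG hjl hj hl hq e he i' hi'
    haveI hfa' : Module.Finite κ (MvPowerSeries (Fin (n - 2)) κ ⧸
        Ideal.span (Set.range fun t => MvPowerSeries.pderiv t a')) :=
      Module.Finite.equiv εa.toLinearEquiv
    haveI hfG' : Module.Finite κ (MvPowerSeries (Fin (n - 2)) κ ⧸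
        Ideal.span (Set.range fun t => MvPowerSeries.pderiv t G')) :=
      Module.Finite.equiv εG.toLinearEquiv
    rw [εa.toLinearEquiv.finrank_eq, εG.toLinearEquiv.finrank_eq]
    exact ih (n - 2) hlt i' (fun t => τ (e t)) a' G' ha' hG0' hG' hfa' hfG'
  · -- no square-free quadratic monomial
    push Not at hpair
    rcases n with _ | _ | _ | n
    · exact i.elim0
    · exact curve_drop i τ hG hfG
    · exact surface_drop_any i τ ha (hpair 0 1 (by decide)) hG hfa hfG
    · exact absurd hfG (caseA_not_finite (by omega) i τ ha hG hG0 hpair)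

end Induction

end MuDropCharTwoOrdP

end Summit.ResolutionOfSingularities.ResolutionOfSingularities.Theorems.WildCones

end
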